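/-
Origin: expansion seat `planner-pub-hodgecm-mc-axioms-1-g14-0`, handover #W208 2026-08-20T15:53:55Z md5 ef770ff17e3e (PKG a1c71cf2e194 → ef770ff17e3e; 208 l.; MECHANICAL (iib-R) rewrite v3.1 of the PKG file as it stands (38 token edits; rules R1x1+RX[h₂]x37)) (`HOME/mc/pub-hodgecm-mc-axioms-1-g14/revendor/kit-r55/stage55/HodgeCM/Model/Binders/Real34PinsCensusT.lean`, md5 ef770ff17e3e, 208 lines);
landed by the gen-22 packager (p-g22) in gate run 55 REPLACES the earlier landed copy of `HodgeCM/Model/Binders/Real34PinsCensusT.lean` (seat copy carried the packager Origin header of an earlier run (stripped)).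
-/
/-
Origin: speedrun cell pub-hodgecm, MODEL-CONSTRUCTION sub-cell, unit pub-hodgecm-mc-binder-1-g11 (BINDER PROVER, gen 11; row 15: the SATISFIABLE
census-side record), seat prover-pub-hodgecm-mc-binder-1-g11-0, 2026-08-20.  Target in PKG: HodgeCM/Model/Binders/Real34PinsCensusT.lean (NEW additive
leaf; imports #40 `Binders/Real34WedgeSpan` (⇒ #38) only).  KERNEL ONLY: 1 hypothesis record
(`Gen12PinsP.Real34CensusSideT`, nothing asserted) + theorems; 0 records of published theorems, nothing cited, 0 `def … : Prop`, MODEL-N ±0,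
E unchanged.  Nothing here is a claim of the manuscripts under adjudication.
-/
import Summits.HodgeConjecture.HodgeCM.Model.Binders.Real34WedgeSpan

/-!
# Row 15 from the (34) census side UP TO (34)-PERIOD EQUIVALENCE (the satisfiable form of `hwedge`)

FINDING (binder-1-g11, STATUS 2026-08-20T07:46Z): the record `Real34CensusSide` of #30/#38 asks `hwedge` for EVERY inserted printed vector,
but admissible (= saturated at `satLevelRegimeOf`, which contains the compact archimedean factors `U(V)(L_w)`, `w ≠ w(ι₁)`) line situations have
VACUUM letters at every archimedean place `w ≠ w(ι₁)`, while the census of a good sextic context inserts `P_b^k`, `k ≥ 1`, at the places `b` where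
the plane `W` is indefinite — so `hwedge` is unsatisfiable there.  Only the (34) PERIODS `ϑ₃₄(χ, ·)` of the inserted vectors matter for row 15
(`gen_mem`), and the inserted printed vectors are `T₃₄(ℝ)`-eigenvectors; hence the satisfiable record:

  `Real34CensusSideT.hwedgeT : ∀ χ f φ, ∃ Ψ ∈ 𝒮^κ, Ψ.1 ∈ admWedgeSpan (S V c) hV ∧ ϑ₃₄ χ (ins f φ) = ϑ₃₄ χ Ψ`

(unmatched letters: `Ψ := 0`, the period vanishing by the torus character; matched letters — `det z` at `ι₁`, vacuum elsewhere: `Ψ := ins f φ`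
with its wedge decomposition).  This leaf proves, at the guarded pins `(Gen12Pins.Wg …, SInstance.SGP @G @hG … @AG)`:

* § 1 **`gen_mem_totalKST hg hcorr hW hAw (CT : Real34CensusSideT …)`** — (K34) at the pinned record (#30 § 2's proof with the generator
  case routed through `hwedgeT` and #40 `exists_wedgeSum_of_mem_admWedgeSpan`);
* § 2 **`real34_totalKSTAt`** — row `real34` PER CONTEXT under the guard from `CT` ((L3), (N1)₂,₃-read-backs, universe facts discharged);
* the sibling leaf `Binders/Real34PinsROGT` instantiates § 2 at `S := SInstance.SROG`, `W := Wg @η_S` (`real34_ROG_of_GOG_T`, `real34_ROGET`).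
-/

set_option autoImplicit false

noncomputable section

open MeasureTheory NumberField MulAction
open scoped Matrix InnerProductSpace TensorProduct

namespace HodgeCM.Model

open HodgeCM HodgeCM.Universe HodgeCM.Adelic HodgeCM.Model.HypCensus
open HodgeCM.PerL34 HodgeCM.PerL34.Fock HodgeCM.PerL34.Fock.PrintDict
open Literature.NumberTheory.Weil1964
open Literature.NumberTheory.Automorphic (piSchwartzBruhat)
open Literature.NumberTheory.Automorphic.UnitaryGroup (archIsotropy archIsotropyProj archKappa archSectionU21CM)
open Literature.NumberTheory.GelbartRogawski1991.UnitaryDualPair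
open Literature.RepresentationTheory.HeisenbergGroup
open Literature.Geometry.ComplexHyperbolic.BallModel (U21 x₀ Jac)
open Literature.AlgebraicGeometry.HodgeTheory
open Literature.NumberTheory.Automorphic.PicardCM
open Literature.NumberTheory.Transcendental (Arapura2012_Cor_15_4_6)
open HodgeCM.CMTypeOps (inflate)
open HodgeCM.Model.ThetaSpace
open HodgeCM.Model.ArchSideTerm
open NumberField.SeesawTorus (charFst charSnd mem_allowedChars)

namespace Gen12PinsP

variable
  (G : ∀ {L : CMField} {ι₁ : L →+* ℂ} (_V : HermSpace3 L ι₁) (_c : SeesawCtx L), Prop)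
  (hG : ∀ {L : CMField} {ι₁ : L →+* ℂ} (V : HermSpace3 L ι₁) (c : SeesawCtx L),
    G V c → (∀ j, 0 < (ι₁ (dW c.D j)).re) ∨ ∀ j, (ι₁ (dW c.D j)).re < 0)
  (hGR : ∀ {L : CMField} {ι₁ : L →+* ℂ} (V : HermSpace3 L ι₁) (c : SeesawCtx L),
    (cmSplittingDatum (L : Type) finProdFinEquiv (frameD V) (frameD_real V) (frameD_ne V) (dW c.D) (dW_real c.D)
      (dW_ne c.D)).CompatibleSplitting)
  (η : ∀ {L : CMField} {ι₁ : L →+* ℂ} (V : HermSpace3 L ι₁) (c : SeesawCtx L),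
    CMAdelic (L : Type) (frameD V) × CMAdelic (L : Type) (dW c.D) →* ℂˣ)
  (hη : ∀ {L : CMField} {ι₁ : L →+* ℂ} (V : HermSpace3 L ι₁) (c : SeesawCtx L),
    ∀ γU ∈ CMRat (L : Type) (frameD V), ∀ γ ∈ CMRat (L : Type) (dW c.D), η V c (γU, γ) = 1)
  (hηc : ∀ {L : CMField} {ι₁ : L →+* ℂ} (V : HermSpace3 L ι₁) (c : SeesawCtx L), Continuous fun p => ((η V c p : ℂˣ) : ℂ))
  (hGR₀ : ∀ {L : CMField} {ι₁ : L →+* ℂ} (V : HermSpace3 L ι₁) (c : SeesawCtx L),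
    (cmSplittingDatum (L : Type) (e₁) (frameD V) (frameD_real V) (frameD_ne V) (lineVec (L : Type) (dW c.D 0))
      (fun _ => dW_real c.D 0) (fun _ => dW_ne c.D 0)).CompatibleSplitting)
  (hGR₁ : ∀ {L : CMField} {ι₁ : L →+* ℂ} (V : HermSpace3 L ι₁) (c : SeesawCtx L),
    (cmSplittingDatum (L : Type) (e₁) (frameD V) (frameD_real V) (frameD_ne V) (lineVec (L : Type) (dW c.D 1))
      (fun _ => dW_real c.D 1) (fun _ => dW_ne c.D 1)).CompatibleSplitting)
  (hGR₂ : ∀ {L : CMField} {ι₁ : L →+* ℂ} (V : HermSpace3 L ι₁) (c : SeesawCtx L),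
    (cmSplittingDatum (L : Type) (e₁) (frameD V) (frameD_real V) (frameD_ne V) (lineVec (L : Type) (dW' c.D 0))
      (fun _ => dW'_real c.D 0) (fun _ => dW'_ne c.D 0)).CompatibleSplitting)
  (hGR₃ : ∀ {L : CMField} {ι₁ : L →+* ℂ} (V : HermSpace3 L ι₁) (c : SeesawCtx L),
    (cmSplittingDatum (L : Type) (e₁) (frameD V) (frameD_real V) (frameD_ne V) (lineVec (L : Type) (dW' c.D 1))
      (fun _ => dW'_real c.D 1) (fun _ => dW'_ne c.D 1)).CompatibleSplitting)
  (AG : ∀ {L : CMField} {ι₁ : L →+* ℂ} (V : HermSpace3 L ι₁) (c : SeesawCtx L), G V c → ∀ k : Fin 4,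
    ArchLineInput V (lineRepD V c.D (hGR V c) (hGR₀ V c) (hGR₁ V c) (hGR₂ V c) (hGR₃ V c) (η V c) k))

variable (hHD : exists_isReal_hodgeModel) (hI : hodgePQ_independent_of_hodgeModel)
  (h₁ : BallQuotientUniformised)  (h₃ : CMAbelianVarietyRealised)
  (h : Bool) (hA : Arapura2012_Cor_15_4_6) (μ : ∀ {L : CMField}, SeesawCtx L → Fin 4 → InfinitePlace L → ℤ)

section Context34

variable {L : CMField} {ι₁ : L →+* ℂ} (V : HermSpace3 L ι₁) (c : SeesawCtx L) (hV : IsAnisotropic L V.Hm)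

/-- **The (34) CENSUS SIDE of a context, UP TO (34)-PERIOD EQUIVALENCE** (the satisfiable form of #30/#38's `Real34CensusSide`): mc-binder-2's
`HypCoreW` of the W pin for the (34) torus at the exponents `(-μ c 2, -μ c 3)`, together with `hwedgeT`: for every (34)-torus index character `χ`
and every inserted printed vector `ins f φ` SOME test function `Ψ ∈ 𝒮^κ` with the same (34) period `ϑ₃₄(χ, Ψ) = ϑ₃₄(χ, ins f φ)` lies in the span of the
single admissible (34) wedges of the guarded S pin (#40 `admWedgeSpan`).  Intended inhabitant: `Ψ := 0` for the letters whose `T₃₄(ℝ)`-character is not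
`χ_∞⁻¹` (period `0`), `Ψ := ins f φ` for the matched letters (`det z` at `ι₁`, vacuum at every other archimedean place).  A HYPOTHESIS record; nothing asserted. -/
structure Real34CensusSideT where
  /-- binder-2's (34) census core of the context at the W pin -/
  core : HypCoreW ((Gen12Pins.Wg @hGR @η @hη @hηc @Gen12Pins.τSyl @Gen12Pins.TSyl @Gen12Pins.hTSyl) V c) c.D.jT₃₄ (fun w => -μ c 2 w) (fun w => -μ c 3 w)
  /-- every inserted printed vector has, character by character, the (34) period of an admissible wedge sum of the guarded S pin -/
  hwedgeT : letI := core.decEq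
    ∀ (χ : ((pinT hHD hI h₁ h₃ h hA (Gen12Pins.Wg @hGR @η @hη @hηc @Gen12Pins.τSyl @Gen12Pins.TSyl @Gen12Pins.hTSyl) (SInstance.SGP @G @hG @hGR @η @hη @hηc @hGR₀ @hGR₁ @hGR₂ @hGR₃ @AG) μ).t34 V c).X)
      (f : core.side.FinIdx)
      (φ : (printPlaces (InfinitePlace (L : Type)) core.kind core.lam core.hlam (pinnedVacs core.kind (fun w => -μ c 2 w) (fun w => -μ c 3 w))).F),
      ∃ Ψ : ↥((wmOf' printFact_unitaryCompact_holds ((Gen12Pins.Wg @hGR @η @hη @hηc @Gen12Pins.τSyl @Gen12Pins.TSyl @Gen12Pins.hTSyl) V c)).SK),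
        (Subtype.val Ψ : piSchwartzBruhat (↥(maximalRealSubfield L)) (Fin 6)) ∈
            admWedgeSpan hHD hI h₁ h₃ ((SInstance.SGP @G @hG @hGR @η @hη @hηc @hGR₀ @hGR₁ @hGR₂ @hGR₃ @AG) V c) hV ∧
          ((pinT hHD hI h₁ h₃ h hA (Gen12Pins.Wg @hGR @η @hη @hηc @Gen12Pins.τSyl @Gen12Pins.TSyl @Gen12Pins.hTSyl) (SInstance.SGP @G @hG @hGR @η @hη @hηc @hGR₀ @hGR₁ @hGR₂ @hGR₃ @AG) μ).t34 V c).ϑ χ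
              (insM printFact_unitaryCompact_holds ((Gen12Pins.Wg @hGR @η @hη @hηc @Gen12Pins.τSyl @Gen12Pins.TSyl @Gen12Pins.hTSyl) V c) c.D.jT₃₄
                core.kind core.lam core.hlam (fun w => -μ c 2 w) (fun w => -μ c 3 w) core.side f φ) =
            ((pinT hHD hI h₁ h₃ h hA (Gen12Pins.Wg @hGR @η @hη @hηc @Gen12Pins.τSyl @Gen12Pins.TSyl @Gen12Pins.hTSyl) (SInstance.SGP @G @hG @hGR @η @hη @hηc @hGR₀ @hGR₁ @hGR₂ @hGR₃ @AG) μ).t34 V c).ϑ χ Ψ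

/-! ## 1. (K34) at the pinned record from the census side up to period equivalence -/

/-- **(K34) at the guarded pins from `Real34CensusSideT`** — #30 § 2 / #38 `gen_mem_totalKS` with the generator case routed through `hwedgeT`:
for an inserted printed vector, `ϑ₃₄(χ, ins f φ) = ϑ₃₄(χ, Ψ)` with `Ψ` an admissible wedge sum (#40 `exists_wedgeSum_of_mem_admWedgeSpan`), then
binder-1 #8 see-saw ∘ D-6 pointwise chain ∘ matched `hRep` exactly as before; linearity of `ϑ₃₄(χ, ·)` (#30 § 1) extends to the span and D-6's
`Real34Loc.gen_mem_of_dense` closes with binder-2's `dense`. -/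
theorem gen_mem_totalKST (hg : G V c)
    (hcorr : ∀ (Γ : Level V), ∀ δ ∈ levelImage hHD hI h₁ h₃ Γ hV,
      ∃ x : (V.latticeModel printFact_unitaryCompact_holds).G, x ∈ satLevelRegimeOf V hV Γ.K ∧
        ((SInstance.SGP @G @hG @hGR @η @hη @hηc @hGR₀ @hGR₁ @hGR₂ @hGR₃ @AG) V c).ιinf δ * x ∈ (V.latticeModel printFact_unitaryCompact_holds).Γ ∧ ∀ y : U21, Commute x (((SInstance.SGP @G @hG @hGR @η @hη @hηc @hGR₀ @hGR₁ @hGR₂ @hGR₃ @AG) V c).ιinf y))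
    (hW : IsAnisotropic L c.D.gramW) (hAw : ∀ k : Fin 4, k = 2 ∨ k = 3 → (AG V c hg k).w = ⇑(archWeight L (μ c k)))
    (CT : Real34CensusSideT @G @hG @hGR @η @hη @hηc @hGR₀ @hGR₁ @hGR₂ @hGR₃ @AG hHD hI h₁ h₃ h hA @μ V c hV) :
    ∀ (χ : ((pinT hHD hI h₁ h₃ h hA (Gen12Pins.Wg @hGR @η @hη @hηc @Gen12Pins.τSyl @Gen12Pins.TSyl @Gen12Pins.hTSyl) (SInstance.SGP @G @hG @hGR @η @hη @hηc @hGR₀ @hGR₁ @hGR₂ @hGR₃ @AG) μ).t34 V c).X)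
      (Φ : (pinT hHD hI h₁ h₃ h hA (Gen12Pins.Wg @hGR @η @hη @hηc @Gen12Pins.τSyl @Gen12Pins.TSyl @Gen12Pins.hTSyl) (SInstance.SGP @G @hG @hGR @η @hη @hηc @hGR₀ @hGR₁ @hGR₂ @hGR₃ @AG) μ).SK V c),
      ((pinT hHD hI h₁ h₃ h hA (Gen12Pins.Wg @hGR @η @hη @hηc @Gen12Pins.τSyl @Gen12Pins.TSyl @Gen12Pins.hTSyl) (SInstance.SGP @G @hG @hGR @η @hη @hηc @hGR₀ @hGR₁ @hGR₂ @hGR₃ @AG) μ).t34 V c).ϑ χ Φ ∈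
        (Submodule.span ℂ (Real34Loc.ofThetaSat hHD hI h₁ h₃ h hA (Gen12Pins.Wg @hGR @η @hη @hηc @Gen12Pins.τSyl @Gen12Pins.TSyl @Gen12Pins.hTSyl) (SInstance.SGP @G @hG @hGR @η @hη @hηc @hGR₀ @hGR₁ @hGR₂ @hGR₃ @AG) μ V c hV
          (hGfin_total @G @hG @hGR @η @hη @hηc @hGR₀ @hGR₁ @hGR₂ @hGR₃ @AG V c hV hg) hcorr).wset).topologicalClosure := by
  letI := CT.core.decEq
  have h2 : (((SInstance.SGP @G @hG @hGR @η @hη @hηc @hGR₀ @hGR₁ @hGR₂ @hGR₃ @AG) V c).P 2).w = ⇑(archWeight L (μ c 2)) :=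
    (ST_P_w @G @hG @hGR @η @hη @hηc @hGR₀ @hGR₁ @hGR₂ @hGR₃ @AG V c hg 2).trans (hAw 2 (Or.inl rfl))
  have h3 : (((SInstance.SGP @G @hG @hGR @η @hη @hηc @hGR₀ @hGR₁ @hGR₂ @hGR₃ @AG) V c).P 3).w = ⇑(archWeight L (μ c 3)) :=
    (ST_P_w @G @hG @hGR @η @hη @hηc @hGR₀ @hGR₁ @hGR₂ @hGR₃ @AG V c hg 3).trans (hAw 3 (Or.inr rfl))
  -- the statement on the span of the inserted vectors, by linearity of `ϑ₃₄(χ, ·)` and `hwedgeT` on the generators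
  have key : ∀ (χ : ((pinT hHD hI h₁ h₃ h hA (Gen12Pins.Wg @hGR @η @hη @hηc @Gen12Pins.τSyl @Gen12Pins.TSyl @Gen12Pins.hTSyl) (SInstance.SGP @G @hG @hGR @η @hη @hηc @hGR₀ @hGR₁ @hGR₂ @hGR₃ @AG) μ).t34 V c).X)
      (Φ : ↥((wmOf' printFact_unitaryCompact_holds ((Gen12Pins.Wg @hGR @η @hη @hηc @Gen12Pins.τSyl @Gen12Pins.TSyl @Gen12Pins.hTSyl) V c)).SK)),
      Φ ∈ Submodule.span ℂ (Set.range fun q : CT.core.side.FinIdx ×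
          (printPlaces (InfinitePlace (L : Type)) CT.core.kind CT.core.lam CT.core.hlam (pinnedVacs CT.core.kind (fun w => -μ c 2 w) (fun w => -μ c 3 w))).F =>
            insM printFact_unitaryCompact_holds ((Gen12Pins.Wg @hGR @η @hη @hηc @Gen12Pins.τSyl @Gen12Pins.TSyl @Gen12Pins.hTSyl) V c) c.D.jT₃₄
              CT.core.kind CT.core.lam CT.core.hlam (fun w => -μ c 2 w) (fun w => -μ c 3 w) CT.core.side q.1 q.2) →
      ((pinT hHD hI h₁ h₃ h hA (Gen12Pins.Wg @hGR @η @hη @hηc @Gen12Pins.τSyl @Gen12Pins.TSyl @Gen12Pins.hTSyl) (SInstance.SGP @G @hG @hGR @η @hη @hηc @hGR₀ @hGR₁ @hGR₂ @hGR₃ @AG) μ).t34 V c).ϑ χ Φ ∈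
        Submodule.span ℂ (Real34Loc.ofThetaSat hHD hI h₁ h₃ h hA (Gen12Pins.Wg @hGR @η @hη @hηc @Gen12Pins.τSyl @Gen12Pins.TSyl @Gen12Pins.hTSyl) (SInstance.SGP @G @hG @hGR @η @hη @hηc @hGR₀ @hGR₁ @hGR₂ @hGR₃ @AG) μ V c hV
          (hGfin_total @G @hG @hGR @η @hη @hηc @hGR₀ @hGR₁ @hGR₂ @hGR₃ @AG V c hV hg) hcorr).wset := by
    intro χ Φ hΦ
    induction hΦ using Submodule.span_induction with
    | mem x hx =>
      obtain ⟨⟨f, φ⟩, rfl⟩ := hx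
      obtain ⟨Ψ, hΨ, hϑ⟩ := CT.hwedgeT χ f φ
      obtain ⟨n, Γ', Sit₂, j₂, Sit₃, j₃, φ₂, φ₃, a, hadm, hφ₂, hφ₃, hΨ1⟩ :=
        exists_wedgeSum_of_mem_admWedgeSpan hHD hI h₁ h₃ _ hV hΨ
      rw [hϑ, t34_ϑ_eq_smul_sum_realise_wedge₂ hHD hI h₁ h₃ h hA (Gen12Pins.Wg @hGR @η @hη @hηc @Gen12Pins.τSyl @Gen12Pins.TSyl @Gen12Pins.hTSyl) (SInstance.SGP @G @hG @hGR @η @hη @hηc @hGR₀ @hGR₁ @hGR₂ @hGR₃ @AG) μ V c hV hW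
        (SeesawHyp34.ofGuarded @G @hG @hGR @η @hη @hηc @hGR₀ @hGR₁ @hGR₂ @hGR₃ @AG V c hg) Γ' Sit₂ j₂ Sit₃ j₃ φ₂ φ₃ hφ₂ hφ₃ a χ Ψ hΨ1]
      refine Submodule.smul_mem _ _ (Submodule.sum_mem _ fun i _ => Submodule.smul_mem _ _ (Submodule.subset_span ?_))
      have hχ := (mem_allowedChars _ _ _).1 χ.2
      exact (Real34Loc.ofThetaSat hHD hI h₁ h₃ h hA (Gen12Pins.Wg @hGR @η @hη @hηc @Gen12Pins.τSyl @Gen12Pins.TSyl @Gen12Pins.hTSyl) (SInstance.SGP @G @hG @hGR @η @hη @hηc @hGR₀ @hGR₁ @hGR₂ @hGR₃ @AG) μ V c hV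
          (hGfin_total @G @hG @hGR @η @hη @hηc @hGR₀ @hGR₁ @hGR₂ @hGR₃ @AG V c hV hg) hcorr).realise_wedge₂_mem_wset
        (Real34Loc.ofThetaSat_rep_thetaGenElt hHD hI h₁ h₃ h hA (Gen12Pins.Wg @hGR @η @hη @hηc @Gen12Pins.τSyl @Gen12Pins.TSyl @Gen12Pins.hTSyl) (SInstance.SGP @G @hG @hGR @η @hη @hηc @hGR₀ @hGR₁ @hGR₂ @hGR₃ @AG) μ V c hV
          (hGfin_total @G @hG @hGR @η @hη @hηc @hGR₀ @hGR₁ @hGR₂ @hGR₃ @AG V c hV hg) hcorr (Γ' i) 2 (Sit₂ i) (hadm i).1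
          (j₂ i) (hadm i).2.1 (charFst χ.1)
          (((((SInstance.SGP @G @hG @hGR @η @hη @hηc @hGR₀ @hGR₁ @hGR₂ @hGR₃ @AG) V c).P 2).residualType_iff_hasArchType_neg h2 (charFst χ.1)).2 (by simpa only [d34Of_m₁] using hχ.1)))
        (Real34Loc.ofThetaSat_rep_thetaGenElt hHD hI h₁ h₃ h hA (Gen12Pins.Wg @hGR @η @hη @hηc @Gen12Pins.τSyl @Gen12Pins.TSyl @Gen12Pins.hTSyl) (SInstance.SGP @G @hG @hGR @η @hη @hηc @hGR₀ @hGR₁ @hGR₂ @hGR₃ @AG) μ V c hV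
          (hGfin_total @G @hG @hGR @η @hη @hηc @hGR₀ @hGR₁ @hGR₂ @hGR₃ @AG V c hV hg) hcorr (Γ' i) 3 (Sit₃ i) (hadm i).2.2.1
          (j₃ i) (hadm i).2.2.2 (charSnd χ.1)
          (((((SInstance.SGP @G @hG @hGR @η @hη @hηc @hGR₀ @hGR₁ @hGR₂ @hGR₃ @AG) V c).P 3).residualType_iff_hasArchType_neg h3 (charSnd χ.1)).2 (by simpa only [d34Of_m₂] using hχ.2)))
    | zero =>
      rw [t34_ϑ_zero hHD hI h₁ h₃ h hA (Gen12Pins.Wg @hGR @η @hη @hηc @Gen12Pins.τSyl @Gen12Pins.TSyl @Gen12Pins.hTSyl) (SInstance.SGP @G @hG @hGR @η @hη @hηc @hGR₀ @hGR₁ @hGR₂ @hGR₃ @AG) μ V c hW χ]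
      exact Submodule.zero_mem _
    | add x y _ _ hx hy =>
      rw [t34_ϑ_add hHD hI h₁ h₃ h hA (Gen12Pins.Wg @hGR @η @hη @hηc @Gen12Pins.τSyl @Gen12Pins.TSyl @Gen12Pins.hTSyl) (SInstance.SGP @G @hG @hGR @η @hη @hηc @hGR₀ @hGR₁ @hGR₂ @hGR₃ @AG) μ V c hW χ x y]
      exact Submodule.add_mem _ hx hy
    | smul a x _ hx =>
      rw [t34_ϑ_smul hHD hI h₁ h₃ h hA (Gen12Pins.Wg @hGR @η @hη @hηc @Gen12Pins.τSyl @Gen12Pins.TSyl @Gen12Pins.hTSyl) (SInstance.SGP @G @hG @hGR @η @hη @hηc @hGR₀ @hGR₁ @hGR₂ @hGR₃ @AG) μ V c hW χ a x]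
      exact Submodule.smul_mem _ a hx
  exact Real34Loc.gen_mem_of_dense hHD hI h₁ h₃ h hA (Gen12Pins.Wg @hGR @η @hη @hηc @Gen12Pins.τSyl @Gen12Pins.TSyl @Gen12Pins.hTSyl) (SInstance.SGP @G @hG @hGR @η @hη @hηc @hGR₀ @hGR₁ @hGR₂ @hGR₃ @AG) μ V c hV _
    (dense_insM printFact_unitaryCompact_holds ((Gen12Pins.Wg @hGR @η @hη @hηc @Gen12Pins.τSyl @Gen12Pins.TSyl @Gen12Pins.hTSyl) V c) c.D.jT₃₄
      CT.core.kind CT.core.lam CT.core.hlam (fun w => -μ c 2 w) (fun w => -μ c 3 w) CT.core.side) key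

/-! ## 2. Row `real34` per context under the guard from the census side up to period equivalence -/

/-- **Row `real34` PER CONTEXT under the guard, from `Real34CensusSideT`** (no family-level hypothesis; (L3) `hcorr` and the universe facts discharged,
as #38 `real34_totalKSAt`). -/
theorem real34_totalKSTAt (hg : G V c)
    (hc : (pinT hHD hI h₁ h₃ h hA (Gen12Pins.Wg @hGR @η @hη @hηc @Gen12Pins.τSyl @Gen12Pins.TSyl @Gen12Pins.hTSyl) (SInstance.SGP @G @hG @hGR @η @hη @hηc @hGR₀ @hGR₁ @hGR₂ @hGR₃ @AG) μ).GoodCtx ι₁ c)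
    (hAw : ∀ k : Fin 4, k = 2 ∨ k = 3 → (AG V c hg k).w = ⇑(archWeight L (μ c k)))
    (hU₂ : ∀ Γ : Level V, (pinT hHD hI h₁ h₃ h hA (Gen12Pins.Wg @hGR @η @hη @hηc @Gen12Pins.τSyl @Gen12Pins.TSyl @Gen12Pins.hTSyl) (SInstance.SGP @G @hG @hGR @η @hη @hηc @hGR₀ @hGR₁ @hGR₂ @hGR₃ @AG) μ).Theta V c 2 Γ ⊆ (picardCMUniverse hHD hI h₁ h₃).Uiso Γ c.K (c.Ψ 2) c.σ)
    (hU₃ : ∀ Γ : Level V, (pinT hHD hI h₁ h₃ h hA (Gen12Pins.Wg @hGR @η @hη @hηc @Gen12Pins.τSyl @Gen12Pins.TSyl @Gen12Pins.hTSyl) (SInstance.SGP @G @hG @hGR @η @hη @hηc @hGR₀ @hGR₁ @hGR₂ @hGR₃ @AG) μ).Theta V c 3 Γ ⊆ (picardCMUniverse hHD hI h₁ h₃).Uiso Γ c.K (c.Ψ 3) c.σ)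
    (CT : Real34CensusSideT @G @hG @hGR @η @hη @hηc @hGR₀ @hGR₁ @hGR₂ @hGR₃ @AG hHD hI h₁ h₃ h hA @μ V c hV) :
    Nonempty ((pinT hHD hI h₁ h₃ h hA (Gen12Pins.Wg @hGR @η @hη @hηc @Gen12Pins.τSyl @Gen12Pins.TSyl @Gen12Pins.hTSyl) (SInstance.SGP @G @hG @hGR @η @hη @hηc @hGR₀ @hGR₁ @hGR₂ @hGR₃ @AG) μ).Real34FunBridge V c) :=
  ⟨((⟨hcorr_total @G @hG @hGR @η @hη @hηc @hGR₀ @hGR₁ @hGR₂ @hGR₃ @AG hHD hI h₁ h₃ V c hV,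
        gen_mem_totalKST @G @hG @hGR @η @hη @hηc @hGR₀ @hGR₁ @hGR₂ @hGR₃ @AG hHD hI h₁ h₃ h hA @μ V c hV hg
          (hcorr_total @G @hG @hGR @η @hη @hηc @hGR₀ @hGR₁ @hGR₂ @hGR₃ @AG hHD hI h₁ h₃ V c hV)
          (hW_total @G @hG @hGR @η @hη @hηc @hGR₀ @hGR₁ @hGR₂ @hGR₃ @AG hHD hI h₁ h₃ h hA @μ c hc) hAw CT,
        hU₂, hU₃⟩ : Real34GuardedResidual @G @hG @hGR @η @hη @hηc @hGR₀ @hGR₁ @hGR₂ @hGR₃ @AG hHD hI h₁ h₃ h hA @μ V c hV hg).toJunctions).toJunctions.funBridge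
      (Model.modelAxiomsPerL hHD hI h₃ h₁).pull_comp (Model.modelAxiomsPerL hHD hI h₃ h₁).pull_cup (Model.modelAxiomsPerL hHD hI h₃ h₁).pull_hodge⟩

end Context34


end Gen12PinsP

end HodgeCM.Model

end
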